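import Mathlib
import Summits.RiemannHypothesis.RiemannHypothesis.Theorems.JensenPolynomialsDefs
import Summits.RiemannHypothesis.RiemannHypothesis.Theorems.JensenPolynomialsCumulantDefs
import Summits.RiemannHypothesis.RiemannHypothesis.Theorems.JensenCumulantSplit
import Summits.RiemannHypothesis.RiemannHypothesis.Theorems.JensenPolynomialsXiCumulantIdentity
import Summits.RiemannHypothesis.RiemannHypothesis.Theorems.JensenPolynomialsTailOfZeroFree
import Summits.RiemannHypothesis.RiemannHypothesis.Theses.JensenPolynomials
import Literature.NumberTheory.LFunctions.XiMoments

/-! # JensenPolynomialsAnalyticSplitGlue — PROVED GLUE of the tenure split of crux 19709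
`XiGorttwCoeffSmallAnalytic := XiGorttwCoeffSmallFrom rhoWinMin 10⁴` of route `JensenPolynomials` into its four OPEN pieces
(director-rh g3 2026-08-26T01:13:37Z (2); cell rh-jensen, theory seat g7; THEORY-JENSEN.md §10.10):

* **B1-rel** `XiWindowZeroFreeRel` — for every `M ≥ 10⁴` the normalised window EGF `F_M(s) = 1 + Σ_{1≤k≤M} r̃_k(M) s^k/k!` of
  `γ = xiTaylorCoeff` has no zero on the disc `‖s‖ ≤ (7/20)·M` and `log ‖F_M(s)·exp(−P₃(s))‖ ≤ (8/3)(7/20)⁴ M³ Δ(M)⁴` there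
  (`P₃(s) = s − Δ²s² + ũ₃s³/6`; typed in the exact `hzf` shape of `hermiteCumulant_abs_le_of_zeroFreeRel`, `θ = 7/20`, `η = 1`);
* **XiDeltaLower052** — `δ(M) := 2M·Δ(M)² ≥ 13/25` for `M ≥ 10⁴` (effective strict Turán inequality; `16·(7/20)²·(13/25) = 1.0192 ≥ 1`);
* **C1a** `XiCumulantSkew98` — the skewness law `q(M) := M·Ũ₃(M)² ≤ 81/2` for `M ≥ 10⁴` (cap `a(3) = 9/8`: `32·(9/8)² = 81/2`);
* **C2⁺_gen** `XiCumulantMajorantCap` — the γ-FREE numeric statement `CumulantMajorantSumGen jensenCap rhoWinMin 10⁴` (unfolded).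

GLUE (this file, sorry-free): `B1-rel → XiDeltaLower052 → C1a → C2⁺_gen → XiGorttwCoeffSmallFrom rhoWinMin 10⁴`, assembled from the LANDED
pieces C0 `xiCumulantIdentity_holds` (p413598), G1/G3-rel `hermiteCumulant_abs_le_of_zeroFreeRel` (p414980/p415479) and the port of the per-order
split glue `xiGorttwCoeffSmallFrom_of_splitGen` (HOME route-prep/port/JensenCumulantSplitGen.lean, theory g5) with `XiDeltaSqPos` WEAKENED to
`Δ(M)² > 0 for M ≥ N` (which `XiDeltaLower052` supplies), so the existing item `XiDeltaSqPos` is NOT a child of this split.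
LABELS (ladder rule §5.4): all four children are RH-FREE statements about ξ's Taylor data `γ(n)` (B1-rel, δ, q) or γ-free numerics (C2⁺_gen);
the complement regime `n < c·d³` of the Hermite sign test is RH-EQUIVALENT and is not touched here; nothing in this file bears on the truth of RH. -/

noncomputable section
-- D-0017: `Summit.RiemannHypothesis.RiemannHypothesis.…` duplicates the namespace BY DESIGN (single-problem summit).
set_option linter.dupNamespace false

open Polynomial Finset
open scoped Nat

namespace Summit.RiemannHypothesis.RiemannHypothesis.Theorems.JensenPolynomials

open Literature.NumberTheory.LFunctions

/-! ## Per-order caps (port of theory g5's `JensenCumulantSplitGen`, verbatim except `XiDeltaSqPos ↦ Δ² > 0 from N on`) -/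

/-- The per-order cap `cap_k(M) := a(k)·(k−1)!·2^{k/2}·M^{−(k−2)/2}` (`envCap A = envCapGen (fun _ => A)`). -/
def envCapGen (a : ℕ → ℝ) (M k : ℕ) : ℝ :=
  a k * ((k - 1)! : ℝ) * (2 : ℝ) ^ ((k : ℝ) / 2) / (M : ℝ) ^ (((k : ℝ) - 2) / 2)

/-- A constant cap table reproduces the constant-`A` envelope `envCap`. -/
theorem envCapGen_const (A : ℝ) (M k : ℕ) : envCapGen (fun _ => A) M k = envCap A M k := rfl

/-- The per-order envelope is nonnegative for a nonnegative cap table. -/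
theorem envCapGen_nonneg {a : ℕ → ℝ} (ha : ∀ k, 0 ≤ a k) (M k : ℕ) : 0 ≤ envCapGen a M k := by
  unfold envCapGen; have := ha k; positivity

/-- The per-order caps DEcrease in `M` (for `k ≥ 2`, `a ≥ 0`, `M ≥ 1`). -/
theorem envCapGen_antitone {a : ℕ → ℝ} (ha : ∀ k, 0 ≤ a k) {M M' k : ℕ} (hM : 1 ≤ M) (hMM : M ≤ M') (hk : 2 ≤ k) :
    envCapGen a M' k ≤ envCapGen a M k := by
  unfold envCapGen
  have hak := ha k
  have hnum : 0 ≤ a k * ((k - 1)! : ℝ) * (2 : ℝ) ^ ((k : ℝ) / 2) := by positivity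
  have he : 0 ≤ ((k : ℝ) - 2) / 2 := by
    have : (2 : ℝ) ≤ k := by exact_mod_cast hk
    linarith
  have hMpos : (0 : ℝ) < (M : ℝ) := by exact_mod_cast hM
  have hpow : (0 : ℝ) < (M : ℝ) ^ (((k : ℝ) - 2) / 2) := Real.rpow_pos_of_pos hMpos _
  have hle : (M : ℝ) ^ (((k : ℝ) - 2) / 2) ≤ (M' : ℝ) ^ (((k : ℝ) - 2) / 2) :=
    Real.rpow_le_rpow hMpos.le (by exact_mod_cast hMM) he
  exact div_le_div_of_nonneg_left hnum hpow hle

/-- **C1_gen (ξ-input, RH-FREE): PER-ORDER envelope of `ξ`'s Hermite-frame window cumulants**,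
`|Ũ_k(M)| ≤ a(k)·(k−1)!·2^{k/2}·M^{−(k−2)/2}` for `M ≥ N`, `3 ≤ k`, `2k³ < M`. -/
def XiCumulantEnvelopeGen (a : ℕ → ℝ) (N : ℕ) : Prop :=
  ∀ M k : ℕ, N ≤ M → 3 ≤ k → 2 * k ^ 3 < M → |hermiteCumulant xiTaylorCoeff M k| ≤ envCapGen a M k

/-- **C2⁺_gen (γ-free, ONE sequence of numbers): the all-plus majorant sums with the per-order caps at the worst shift
`M_d = max(N, 2d³) + d` are `< 1`.** -/
def CumulantMajorantSumGen (a : ℕ → ℝ) (ρ : ℕ → ℕ → ℝ) (N : ℕ) : Prop :=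
  ∀ d : ℕ, 3 ≤ d →
    (∑ j ∈ range d, (d.descFactorial (j + 1) : ℝ) *
        cumulantCoeff (envCapGen a (max N (2 * d ^ 3) + d)) (j + 1) * ρ d (j + 1) < 1) ∧
    (∑ j ∈ range d, (d.descFactorial (j + 1) : ℝ) *
        cumulantCoeff (envCapGen a (max N (2 * d ^ 3) + d)) (j + 1) * (2 / hermiteTestBound d) ^ (j + 1) < 1)

/-- **PROVED (kernel glue of the per-order split, any cap sequence `a ≥ 0`, any table nonnegative on `3 ≤ d`, `1 ≤ j ≤ d`, any `N`):**
`C0(ξ) → (Δ(M)² > 0 for M ≥ N) → C1_gen(a, N) → C2⁺_gen(a, ρ, N) → S-C on n ≥ N`.  (`XiDeltaSqPos` weakened to `M ≥ N`: the coefficient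
identity is only ever used at `M = n + d ≥ n ≥ N`.) -/
theorem xiGorttwCoeffSmallFrom_of_splitGenFrom {a : ℕ → ℝ} {ρ : ℕ → ℕ → ℝ} {N : ℕ} (ha : ∀ k, 0 ≤ a k)
    (hρ : ∀ d j, 3 ≤ d → 1 ≤ j → j ≤ d → 0 ≤ ρ d j)
    (hId : CumulantCoeffIdentity xiTaylorCoeff) (hΔ : ∀ M : ℕ, N ≤ M → 0 < gorttwDeltaSq xiTaylorCoeff M)
    (h1 : XiCumulantEnvelopeGen a N) (h2 : CumulantMajorantSumGen a ρ N) : XiGorttwCoeffSmallFrom ρ N := by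
  intro d n hd hn hNn
  have hpos : ∀ m, 0 < xiTaylorCoeff m := xiTaylorCoeff_pos_holds
  have hΔM : 0 < gorttwDeltaSq xiTaylorCoeff (n + d) := hΔ (n + d) (by omega)
  have hγ0 : xiTaylorCoeff (n + d) ≠ 0 := (hpos _).ne'
  have hγ1 : xiTaylorCoeff (n + d - 1) ≠ 0 := (hpos _).ne'
  set U : ℕ → ℝ := hermiteCumulant xiTaylorCoeff (n + d) with hU
  set M0 : ℕ := max N (2 * d ^ 3) + d with hM0def
  have hM0 : M0 ≤ n + d := by
    have : max N (2 * d ^ 3) ≤ n := max_le hNn hn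
    omega
  have hM0pos : 1 ≤ M0 := by omega
  have henv : ∀ k : ℕ, 3 ≤ k → k ≤ d → |U k| ≤ envCapGen a (n + d) k := by
    intro k hk3 hkd
    have hNM : N ≤ n + d := by omega
    have hk : 2 * k ^ 3 < n + d := by
      have : k ^ 3 ≤ d ^ 3 := Nat.pow_le_pow_left hkd 3
      omega
    exact h1 (n + d) k hNM hk3 hk
  have hcapmono : ∀ k, 3 ≤ k → k ≤ d → |envCapGen a (n + d) k| ≤ envCapGen a M0 k := by
    intro k hk _
    rw [abs_of_nonneg (envCapGen_nonneg ha _ _)]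
    exact envCapGen_antitone ha hM0pos hM0 (by omega)
  have hterm : ∀ j ∈ range d, |cumulantCoeff U (j + 1)| ≤ cumulantCoeff (envCapGen a M0) (j + 1) := by
    intro j hj
    have hjd : j + 1 ≤ d := by have := mem_range.1 hj; omega
    obtain ⟨hle1, -⟩ := cumulantCoeff_abs_le U (envCapGen a (n + d)) d henv (j + 1) hjd
    obtain ⟨hle2, -⟩ := cumulantCoeff_abs_le (envCapGen a (n + d)) (envCapGen a M0) d hcapmono (j + 1) hjd
    exact hle1.trans ((le_abs_self _).trans hle2)
  have key : ∀ j ∈ range d, |gorttwCoeff xiTaylorCoeff d n (j + 1)| =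
      (d.descFactorial (j + 1) : ℝ) * |cumulantCoeff U (j + 1)| := by
    intro j hj
    rw [Finset.mem_range] at hj
    rw [hId d n (j + 1) hd (by omega) hΔM hγ0 hγ1, abs_mul, Nat.abs_cast]
  have hB : 0 ≤ 2 / hermiteTestBound d :=
    div_nonneg (by norm_num) (by unfold hermiteTestBound; positivity : (0 : ℝ) < hermiteTestBound d).le
  obtain ⟨hS1, hS2⟩ := h2 d hd
  refine ⟨?_, ?_⟩
  · calc ∑ j ∈ range d, |gorttwCoeff xiTaylorCoeff d n (j + 1)| * ρ d (j + 1)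
        = ∑ j ∈ range d, (d.descFactorial (j + 1) : ℝ) * |cumulantCoeff U (j + 1)| * ρ d (j + 1) :=
          Finset.sum_congr rfl (fun j hj => by rw [key j hj])
      _ ≤ ∑ j ∈ range d, (d.descFactorial (j + 1) : ℝ) *
            cumulantCoeff (envCapGen a M0) (j + 1) * ρ d (j + 1) :=
          Finset.sum_le_sum (fun j hj =>
            mul_le_mul_of_nonneg_right (mul_le_mul_of_nonneg_left (hterm j hj) (Nat.cast_nonneg _))
              (hρ d (j + 1) hd (by omega) (by have := mem_range.1 hj; omega)))
      _ < 1 := hS1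
  · calc ∑ j ∈ range d, |gorttwCoeff xiTaylorCoeff d n (j + 1)| * (2 / hermiteTestBound d) ^ (j + 1)
        = ∑ j ∈ range d, (d.descFactorial (j + 1) : ℝ) * |cumulantCoeff U (j + 1)| *
            (2 / hermiteTestBound d) ^ (j + 1) :=
          Finset.sum_congr rfl (fun j hj => by rw [key j hj])
      _ ≤ ∑ j ∈ range d, (d.descFactorial (j + 1) : ℝ) *
            cumulantCoeff (envCapGen a M0) (j + 1) * (2 / hermiteTestBound d) ^ (j + 1) :=
          Finset.sum_le_sum (fun j hj =>
            mul_le_mul_of_nonneg_right (mul_le_mul_of_nonneg_left (hterm j hj) (Nat.cast_nonneg _)) (pow_nonneg hB _))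
      _ < 1 := hS2

/-- **The route's cap sequence:** `a(3) = 9/8` (`⟺ q(M) ≤ 81/2`), `a(k) = k·4^{k−3}/3` for `k ≥ 4` (the Cauchy-estimate caps of G3-rel). -/
def jensenCap (k : ℕ) : ℝ := if k ≤ 3 then 9 / 8 else (k : ℝ) * 4 ^ (k - 3) / 3

/-- The Jensen cap table `(9/8; k·4^{k−3}/3)` is nonnegative. -/
theorem jensenCap_nonneg (k : ℕ) : 0 ≤ jensenCap k := by
  unfold jensenCap; split_ifs <;> positivity

/-- The `k = 3` cap squared: `(envCapGen jensenCap M 3)² = 81/(2M)` — i.e. `|Ũ₃| ≤ cap₃(M) ⟺ q(M) = M·Ũ₃² ≤ 81/2`. -/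
theorem envCapGen_jensenCap_three_sq (M : ℕ) (hM : 1 ≤ M) : envCapGen jensenCap M 3 ^ 2 = 81 / (2 * (M : ℝ)) := by
  have hMpos : (0 : ℝ) < (M : ℝ) := by exact_mod_cast hM
  have h2 : ((2 : ℝ) ^ ((3 : ℝ) / 2)) ^ 2 = 8 := by
    rw [← Real.rpow_natCast, ← Real.rpow_mul (by norm_num : (0 : ℝ) ≤ 2)]
    norm_num
  have hMhalf : ((M : ℝ) ^ ((((3 : ℕ) : ℝ) - 2) / 2)) ^ 2 = (M : ℝ) := by
    rw [← Real.rpow_natCast, ← Real.rpow_mul hMpos.le]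
    norm_num
  have hfact : (((3 : ℕ) - 1)! : ℝ) = 2 := by norm_num [Nat.factorial]
  have hcap : jensenCap 3 = 9 / 8 := by simp [jensenCap]
  unfold envCapGen
  rw [hcap, hfact, div_pow, mul_pow, mul_pow, hMhalf]
  have h2' : ((2 : ℝ) ^ (((3 : ℕ) : ℝ) / 2)) ^ 2 = 8 := by
    simpa using h2
  rw [h2']
  field_simp
  ring

/-- From the skewness law `M·Ũ₃(M)² ≤ 81/2` to the `k = 3` slice of the per-order envelope. -/
theorem hermiteCumulant_three_le_cap_of_q {M : ℕ} (hM : 1 ≤ M)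
    (hq : (M : ℝ) * hermiteCumulant xiTaylorCoeff M 3 ^ 2 ≤ 81 / 2) :
    |hermiteCumulant xiTaylorCoeff M 3| ≤ envCapGen jensenCap M 3 := by
  have hMpos : (0 : ℝ) < (M : ℝ) := by exact_mod_cast hM
  have hc : 0 ≤ envCapGen jensenCap M 3 := envCapGen_nonneg jensenCap_nonneg M 3
  have hsq : hermiteCumulant xiTaylorCoeff M 3 ^ 2 ≤ envCapGen jensenCap M 3 ^ 2 := by
    rw [envCapGen_jensenCap_three_sq M hM, le_div_iff₀ (by positivity)]
    linarith
  calc |hermiteCumulant xiTaylorCoeff M 3| = Real.sqrt (hermiteCumulant xiTaylorCoeff M 3 ^ 2) :=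
        (Real.sqrt_sq_eq_abs _).symm
    _ ≤ Real.sqrt (envCapGen jensenCap M 3 ^ 2) := Real.sqrt_le_sqrt hsq
    _ = envCapGen jensenCap M 3 := Real.sqrt_sq hc

/-- **THE SPLIT GLUE (PROVED): B1-rel → XiDeltaLower052 → C1a (q ≤ 81/2) → C2⁺_gen(jensenCap, rhoWinMin, 10⁴) ⟹
`XiGorttwCoeffSmallFrom rhoWinMin 10000` (= the body of the route item `XiGorttwCoeffSmallAnalytic`).**  The four hypotheses are stated
LITERALLY as the four children of the route split (same texts as in `Theses/JensenPolynomials.lean`). -/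
theorem xiGorttwCoeffSmallAnalytic_of_zeroFreeSplit
    (hB1 : ∀ M : ℕ, 10000 ≤ M → ∀ s : ℂ, ‖s‖ ≤ (7 / 20 : ℝ) * M →
      (1 + ∑ k ∈ Finset.Icc 1 M, (((windowSeqDown xiTaylorCoeff M k / (Nat.factorial k : ℝ) : ℝ)) : ℂ) * s ^ k) ≠ 0 ∧
        Real.log ‖(1 + ∑ k ∈ Finset.Icc 1 M, (((windowSeqDown xiTaylorCoeff M k / (Nat.factorial k : ℝ) : ℝ)) : ℂ) * s ^ k) *
          Complex.exp (-(s - ((gorttwDeltaSq xiTaylorCoeff M : ℝ) : ℂ) * s ^ 2 +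
            ((gorttwU3 xiTaylorCoeff M : ℝ) : ℂ) * s ^ 3 / 6))‖ ≤
          1 * (8 / 3) * (7 / 20 : ℝ) ^ 4 * (M : ℝ) ^ 3 * (gorttwDeltaSq xiTaylorCoeff M) ^ 2)
    (hδ : ∀ M : ℕ, 10000 ≤ M → (13 / 25 : ℝ) ≤ 2 * (M : ℝ) * gorttwDeltaSq xiTaylorCoeff M)
    (hq : ∀ M : ℕ, 10000 ≤ M → (M : ℝ) * hermiteCumulant xiTaylorCoeff M 3 ^ 2 ≤ 81 / 2)
    (h2 : ∀ d : ℕ, 3 ≤ d →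
      (∑ j ∈ Finset.range d, (d.descFactorial (j + 1) : ℝ) *
          cumulantCoeff (fun k : ℕ => (if k ≤ 3 then (9 / 8 : ℝ) else (k : ℝ) * 4 ^ (k - 3) / 3) *
            (Nat.factorial (k - 1) : ℝ) * (2 : ℝ) ^ ((k : ℝ) / 2) /
              ((max 10000 (2 * d ^ 3) + d : ℕ) : ℝ) ^ (((k : ℝ) - 2) / 2)) (j + 1) * rhoWinMin d (j + 1) < 1) ∧
      (∑ j ∈ Finset.range d, (d.descFactorial (j + 1) : ℝ) *
          cumulantCoeff (fun k : ℕ => (if k ≤ 3 then (9 / 8 : ℝ) else (k : ℝ) * 4 ^ (k - 3) / 3) *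
            (Nat.factorial (k - 1) : ℝ) * (2 : ℝ) ^ ((k : ℝ) / 2) /
              ((max 10000 (2 * d ^ 3) + d : ℕ) : ℝ) ^ (((k : ℝ) - 2) / 2)) (j + 1) * (2 / hermiteTestBound d) ^ (j + 1) < 1)) :
    XiGorttwCoeffSmallFrom rhoWinMin 10000 := by
  -- Δ(M)² > 0 from 10⁴ on, from the effective lower bound δ(M) ≥ 13/25.
  have hΔ : ∀ M : ℕ, 10000 ≤ M → 0 < gorttwDeltaSq xiTaylorCoeff M := by
    intro M hM
    have hMpos : (0 : ℝ) < (M : ℝ) := by exact_mod_cast (show 0 < M by omega)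
    have h := hδ M hM
    by_contra hle
    push Not at hle
    have : 2 * (M : ℝ) * gorttwDeltaSq xiTaylorCoeff M ≤ 0 :=
      mul_nonpos_of_nonneg_of_nonpos (by positivity) hle
    linarith
  -- C1_gen(jensenCap, 10⁴): k = 3 from the skewness law, k ≥ 4 from B1-rel via G3-rel (Cauchy estimates on the zero-free disc).
  have h1 : XiCumulantEnvelopeGen jensenCap 10000 := by
    intro M k hM hk3 hkM
    have hM1 : 1 ≤ M := by omega
    rcases Nat.lt_or_ge k 4 with hlt | hge
    · have hk : k = 3 := by omega
      subst hk
      exact hermiteCumulant_three_le_cap_of_q hM1 (hq M hM)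
    · have hkM' : k ≤ M := by
        have : k ≤ k ^ 3 := Nat.le_self_pow (by norm_num) k
        omega
      have hG3 := hermiteCumulant_abs_le_of_zeroFreeRel xiTaylorCoeff M (7 / 20) 1 (13 / 25) (by norm_num) le_rfl
        (by norm_num) hM1 (hΔ M hM) (hδ M hM) (hB1 M hM) k hge hkM'
      have hcap : jensenCap k = (k : ℝ) * 4 ^ (k - 3) / 3 := by
        simp [jensenCap, show ¬ k ≤ 3 by omega]
      unfold envCapGen
      rw [hcap]
      exact hG3
  -- C2⁺_gen(jensenCap, rhoWinMin, 10⁴) is the hypothesis `h2` with `envCapGen jensenCap` folded.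
  have h2' : CumulantMajorantSumGen jensenCap rhoWinMin 10000 := by
    intro d hd
    exact h2 d hd
  exact xiGorttwCoeffSmallFrom_of_splitGenFrom jensenCap_nonneg (fun d j hd hj _ => rhoWinMin_nonneg d j hd hj)
    xiCumulantIdentity_holds hΔ h1 h2'

end Summit.RiemannHypothesis.RiemannHypothesis.Theorems.JensenPolynomials


/-! ## Item closer — compiles once `ledger route edit --split XiGorttwCoeffSmallAnalytic … --glue-decl-name XiGorttwCoeffSmallAnalyticOfZeroFreeSplit`
has rendered the generated glue item `XiGorttwCoeffSmallAnalyticOfZeroFreeSplit : Prop := XiWindowZeroFreeRel → XiDeltaLower052 → XiCumulantSkew98 →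
XiCumulantMajorantCap → XiGorttwCoeffSmallAnalytic` in `Theses/JensenPolynomials.lean` (the four children are `def`s whose bodies are the four
hypotheses above verbatim, so the closer is the glue theorem itself, by `δ`-unfolding; emulated farm check rc 0 in the theory seat's folder). -/

namespace Summit.RiemannHypothesis.RiemannHypothesis.Theorems.JensenPolynomials

/-- **Item closer** for the route's split-glue item `XiGorttwCoeffSmallAnalyticOfZeroFreeSplit`
(stmt-RiemannHypothesis-19218): the four children imply the parent crux `XiGorttwCoeffSmallAnalytic`. RH-FREE. -/
theorem xiGorttwCoeffSmallAnalyticOfZeroFreeSplit_item :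
    Summit.RiemannHypothesis.RiemannHypothesis.Theses.JensenPolynomials.XiGorttwCoeffSmallAnalyticOfZeroFreeSplit :=
  xiGorttwCoeffSmallAnalytic_of_zeroFreeSplit

end Summit.RiemannHypothesis.RiemannHypothesis.Theorems.JensenPolynomials

end
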